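import Mathlib
import HarnessLib
import Summits.AtomisticToContinuum.FouriersLaw.Theorems.VanishingNoiseTransferNoisyFourierAbelMonotoneAux1

/-!
# Zero-frequency storage decay ⇐ PATTERN-storage decay: the flip-charged part of an Abel corrector is free
# (line `abel-storage-decay`, crux `VanishingNoiseTransfer.NoisyFourier`, stmt-AtomisticToContinuum-11977, lead c6)

`--supports stmt-AtomisticToContinuum-11977` file. Setting as in `…NoisyFourierAbelTransfer`: the pinned anharmonic
chain `𝐏 = pinnedChain ω₂ lam β γ` (parameters `> 0`), `T > 0`, Gibbs measure `μ_T = 𝐏.gibbsMeasure L T`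
(invariant under every single-site momentum flip `θ_i`), flip-noisy equilibrium generator
`L_ε = 𝐏.flipGenerator L T T ε` (`ε > 0`), total current `J = Σ_i j_i`, CLASSICAL Abel correctors
`u ∈ C² ∩ L²(μ_T)` with `L_ε u = s u − J` pointwise, and the PATTERN AVERAGE
`P₀u(q,p) = 2^{-L} Σ_{w ∈ {0,1}^L} u(q, (±_w p_i)_i)` — the `L²(μ_T)`-orthogonal projection onto the functions
that are even in EVERY momentum separately (the kernel of the flip Dirichlet form).

The registered core stub U⁺ `stub_zeroFrequencyStorageDecay` of the line asks for `s·∫u_{L,s}² ≤ C(L−1)s^a`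
(`a ∈ (0,1]`) for all `L ≥ 2`, `s ∈ (0,1]`. This file shows that only the PATTERN component `P₀u` of the
corrector carries open content:

* `integral_sq_eq_pattern_add` — Pythagoras: `∫ u² dμ = ∫ (P₀u)² dμ + ∫ (u − P₀u)² dμ` for any flip-invariant
  measure (Efron–Stein orthogonality `flipAvg_orth` of the landed sector-gap file);
* `corrector_chargedStorage_le` — the flip-charged storage of a corrector is FREE and `s`-INDEPENDENT:
  `∫ (u − P₀u)² dμ_T ≤ L M₁/(4ε²)` (`M₁` the `L`-uniform half-current second-moment bound), by the landed sector
  gap `4‖u − P₀u‖² ≤ E(u)` (`stub_flipSectorGap`, p129956) and the corrector flip-energy bound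
  `E(u) ≤ L M₁/ε²` (`corrector_flipEnergy_le`);
* `storageDecay_of_patternStorageDecay` — hence PATTERN-STORAGE DECAY
  `s·∫(P₀u_{L,s})² ≤ C(L−1)s^a` (all `L ≥ 2`, `s ∈ (0,1]`) implies U⁺ verbatim with the constant
  `C + M₁/(2ε²)` (`s ≤ s^a` on `(0,1]`, `L ≤ 2(L−1)`);
* `helper_storageDecayOfPatternStorageDecay` — registered notation-free restatement.

So the open content of U⁺ is the storage of the jointly-even part `P₀u_{L,s}` of the corrector — c4's Kapitza
quantity `‖P₀u_s‖²` with an integrable rate in place of a uniform bound. References: Bernardin–Olla 2011 §3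
(sector/entropy bound); folklore (Fourier–Walsh on `ℤ₂^L`). No definitions; axioms `propext`, `Classical.choice`,
`Quot.sound` only.
-/

noncomputable section

open MeasureTheory Filter Topology
open scoped BigOperators
open Literature.MathematicalPhysics.KineticTheory.HeatConduction
open Summit.AtomisticToContinuum.FouriersLaw.Theorems.VanishingNoiseBound (gibbs_flipInvariant)
open Summit.AtomisticToContinuum.FouriersLaw.Theorems.NoisyFourier.FlipCeiling (gibbsHalfCurrentSqLe)
open Summit.AtomisticToContinuum.FouriersLaw.Cruxes.NoisyFourier.AbelKapitzaEvenCorrector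
  (stub_flipSectorGap exists_natFlip flipAvg_orth flipAvg_even flipAvg_memLp flipAvg_closed_form_top)
open Summit.AtomisticToContinuum.FouriersLaw.Cruxes.NoisyFourier.AbelKapitzaEvenCorrector.AbelTransfer
  (corrector_flipEnergy_le memLp_patternAverage)

namespace Summit.AtomisticToContinuum.FouriersLaw.Theorems.NoisyFourier.StorageDecay

variable {L : ℕ}

/-- **Pythagoras for the pattern average.** For a measure on phase space invariant under every single-site
momentum flip and `u ∈ L²`: `∫ u² = ∫ (P₀u)² + ∫ (u − P₀u)²` (`u − P₀u ⊥ P₀u` by `flipAvg_orth`, `P₀u` being even in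
every momentum). [folklore] -/
theorem integral_sq_eq_pattern_add (μ : Measure (PhaseSpace L))
    (hμ : ∀ i : Fin L, MeasurePreserving (momentumFlip i) μ μ) {u : PhaseSpace L → ℝ} (hu : MemLp u 2 μ) :
    ∫ x, u x ^ 2 ∂μ =
      (∫ x, ((∑ w : Fin L → Bool, u (x.1, fun i => if w i then -x.2 i else x.2 i)) / 2 ^ L) ^ 2 ∂μ) +
        ∫ x, (u x - (∑ w : Fin L → Bool, u (x.1, fun i => if w i then -x.2 i else x.2 i)) / 2 ^ L) ^ 2 ∂μ := by
  obtain ⟨θ, hθfin, hθμ, hθi, hθc⟩ := exists_natFlip L μ hμ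
  obtain ⟨F, hF0, hFs⟩ : ∃ F : ℕ → PhaseSpace L → ℝ,
      (∀ x, F 0 x = u x) ∧ ∀ k x, F (k + 1) x = (F k x + F k (θ k x)) / 2 :=
    ⟨fun n => Nat.rec u (fun k Fk x => (Fk x + Fk (θ k x)) / 2) n, fun _ => rfl, fun _ _ => rfl⟩
  set g : PhaseSpace L → ℝ := F L with hg
  have hcl : ∀ x, (∑ w : Fin L → Bool, u (x.1, fun i => if w i then -x.2 i else x.2 i)) / 2 ^ L = g x :=
    fun x => (flipAvg_closed_form_top u hθfin hF0 hFs x).symm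
  have hg2 : MemLp g 2 μ := flipAvg_memLp hθμ hu hF0 hFs L
  have hge : ∀ k, k < L → ∀ x, g (θ k x) = g x := fun k hk x => flipAvg_even hθi hθc hFs L k hk x
  have horth : ∫ x, (u x - g x) * g x ∂μ = 0 := flipAvg_orth hθμ hθi hu hF0 hFs L g hg2 hge
  have i1 : Integrable (fun x => (u x - g x) ^ 2) μ := (hu.sub hg2).integrable_sq
  have i2 : Integrable (fun x => (u x - g x) * g x) μ := (hu.sub hg2).integrable_mul hg2
  have i3 : Integrable (fun x => g x ^ 2) μ := hg2.integrable_sq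
  have e : (fun x => u x ^ 2) = fun x => (u x - g x) ^ 2 + 2 * ((u x - g x) * g x) + g x ^ 2 := by
    funext x; ring
  have i2' : Integrable (fun x => 2 * ((u x - g x) * g x)) μ := i2.const_mul 2
  have i12 : Integrable (fun x => (u x - g x) ^ 2 + 2 * ((u x - g x) * g x)) μ := i1.add i2'
  simp_rw [hcl]
  rw [e, integral_add i12 i3, integral_add i1 i2', integral_const_mul, horth]
  ring

section Chain

variable {ω₂ lam β γ : ℝ}

/-- **The flip-charged storage of a corrector is free**: for a classical Abel corrector `u` at `s ≥ 0` with
half-current second moments `≤ M₁`, `∫ (u − P₀u)² dμ_T ≤ L M₁/(4ε²)` (sector gap `4‖u − P₀u‖² ≤ E(u)` and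
`E(u) ≤ L M₁/ε²`). [cite: BernardinOlla2011, §3] -/
theorem corrector_chargedStorage_le (hω : 0 < ω₂) (hl : 0 < lam) (hβ : 0 < β) (hγ : 0 < γ) {T : ℝ}
    (hT : 0 < T) {ε : ℝ} (hε : 0 < ε) {s : ℝ} (hs : 0 ≤ s) {u : PhaseSpace L → ℝ} (huC : ContDiff ℝ 2 u)
    (hu2 : MemLp u 2 ((pinnedChain ω₂ lam β γ).gibbsMeasure L T))
    (hpde : ∀ x, (pinnedChain ω₂ lam β γ).flipGenerator L T T ε u x =
      s * u x - ∑ i, (pinnedChain ω₂ lam β γ).bondCurrent L i x)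
    {M₁ : ℝ} (hM : ∀ k i j : Fin L,
      MemLp (fun x : PhaseSpace L => x.2 k * deriv (pinnedChain ω₂ lam β γ).V (x.1 j - x.1 i)) 2
          ((pinnedChain ω₂ lam β γ).gibbsMeasure L T) ∧
        ∫ x, (x.2 k * deriv (pinnedChain ω₂ lam β γ).V (x.1 j - x.1 i)) ^ 2
          ∂((pinnedChain ω₂ lam β γ).gibbsMeasure L T) ≤ M₁) :
    ∫ x, (u x - (∑ w : Fin L → Bool, u (x.1, fun i => if w i then -x.2 i else x.2 i)) / 2 ^ L) ^ 2
        ∂((pinnedChain ω₂ lam β γ).gibbsMeasure L T) ≤ L * M₁ / (4 * ε ^ 2) := by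
  have hflip := gibbs_flipInvariant (ω₂ := ω₂) (lam := lam) (β := β) (γ := γ) L T
  have hgap := stub_flipSectorGap L ((pinnedChain ω₂ lam β γ).gibbsMeasure L T) hflip u hu2
  have hE := corrector_flipEnergy_le hω hl hβ hγ hT hε hs huC hu2 hpde hM
  rw [le_div_iff₀ (by positivity)]
  have e : (L : ℝ) * M₁ = L * M₁ / ε ^ 2 * ε ^ 2 := by field_simp
  nlinarith [hgap, hE, e, sq_nonneg ε]

/-- **Pattern-storage decay ⇒ zero-frequency storage decay (U⁺).** If for all parameters there are
`a ∈ (0,1]`, `C ≥ 0` with `s·∫(P₀u)² dμ_T ≤ C(L−1)s^a` for every `L ≥ 2`, `s ∈ (0,1]` and every classical Abel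
corrector `u` at `s`, then `s·∫u² dμ_T ≤ (C + M₁/(2ε²))(L−1)s^a` likewise: Pythagoras, the free charged storage
`≤ L M₁/(4ε²)`, `s ≤ s^a` on `(0,1]` and `L ≤ 2(L−1)`. [folklore] -/
theorem storageDecay_of_patternStorageDecay
    (hPS : ∀ (ω₂ lam β γ T ε : ℝ), 0 < ω₂ → 0 < lam → 0 < β → 0 < γ → 0 < T → 0 < ε →
      ∃ a C : ℝ, 0 < a ∧ a ≤ 1 ∧ 0 ≤ C ∧ ∀ (L : ℕ), 2 ≤ L → ∀ s : ℝ, 0 < s → s ≤ 1 →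
        ∀ u : PhaseSpace L → ℝ,
          (ContDiff ℝ 2 u ∧ MemLp u 2 ((pinnedChain ω₂ lam β γ).gibbsMeasure L T) ∧
            ∀ x, (pinnedChain ω₂ lam β γ).flipGenerator L T T ε u x =
              s * u x - ∑ i : Fin L, (pinnedChain ω₂ lam β γ).bondCurrent L i x) →
          s * ∫ x, ((∑ w : Fin L → Bool, u (x.1, fun i => if w i then -x.2 i else x.2 i)) / 2 ^ L) ^ 2
              ∂((pinnedChain ω₂ lam β γ).gibbsMeasure L T) ≤ C * ((L : ℝ) - 1) * s ^ a) :
    ∀ (ω₂ lam β γ T ε : ℝ), 0 < ω₂ → 0 < lam → 0 < β → 0 < γ → 0 < T → 0 < ε →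
      ∃ a C : ℝ, 0 < a ∧ a ≤ 1 ∧ 0 ≤ C ∧ ∀ (L : ℕ), 2 ≤ L → ∀ s : ℝ, 0 < s → s ≤ 1 →
        ∀ u : PhaseSpace L → ℝ,
          (ContDiff ℝ 2 u ∧ MemLp u 2 ((pinnedChain ω₂ lam β γ).gibbsMeasure L T) ∧
            ∀ x, (pinnedChain ω₂ lam β γ).flipGenerator L T T ε u x =
              s * u x - ∑ i : Fin L, (pinnedChain ω₂ lam β γ).bondCurrent L i x) →
          s * ∫ x, u x ^ 2 ∂((pinnedChain ω₂ lam β γ).gibbsMeasure L T) ≤ C * ((L : ℝ) - 1) * s ^ a := by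
  intro ω₂ lam β γ T ε hω hl hβ hγ hT hε
  obtain ⟨a, C, ha, ha1, hC, hP⟩ := hPS ω₂ lam β γ T ε hω hl hβ hγ hT hε
  obtain ⟨M₁, hM⟩ := gibbsHalfCurrentSqLe hω hl.le hβ.le γ hT
  -- `0 ≤ M₁` (instantiate the moment bound once)
  have hM0 : 0 ≤ M₁ :=
    le_trans (integral_nonneg fun x => sq_nonneg _) (hM 1 0 0 0).2
  refine ⟨a, C + M₁ / (2 * ε ^ 2), ha, ha1, by positivity, fun L hL s hs hs1 u hu => ?_⟩
  obtain ⟨huC, hu2, hpde⟩ := hu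
  set μ := (pinnedChain ω₂ lam β γ).gibbsMeasure L T with hμ
  have hflip := gibbs_flipInvariant (ω₂ := ω₂) (lam := lam) (β := β) (γ := γ) L T
  have hpyth := integral_sq_eq_pattern_add μ hflip hu2
  have hch := corrector_chargedStorage_le hω hl hβ hγ hT hε hs.le huC hu2 hpde (hM L)
  have hpat := hP L hL s hs hs1 u ⟨huC, hu2, hpde⟩
  -- `s ≤ s^a` on `(0,1]` and `L ≤ 2(L-1)`
  have hsa : s ≤ s ^ a := by
    calc s = s ^ (1 : ℝ) := (Real.rpow_one s).symm
      _ ≤ s ^ a := Real.rpow_le_rpow_of_exponent_ge hs hs1 ha1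
  have hL2 : (2 : ℝ) ≤ L := by exact_mod_cast hL
  have hL1 : (0 : ℝ) ≤ (L : ℝ) - 1 := by linarith
  have hLL : (L : ℝ) ≤ 2 * ((L : ℝ) - 1) := by linarith
  have hsa0 : 0 ≤ s ^ a := (Real.rpow_pos_of_pos hs a).le
  -- the charged part: `s · L M₁/(4ε²) ≤ (M₁/(2ε²)) (L-1) s^a`
  have hcharged : s * (L * M₁ / (4 * ε ^ 2)) ≤ M₁ / (2 * ε ^ 2) * ((L : ℝ) - 1) * s ^ a := by
    have h1 : s * (L * M₁ / (4 * ε ^ 2)) ≤ s ^ a * (L * M₁ / (4 * ε ^ 2)) :=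
      mul_le_mul_of_nonneg_right hsa (by positivity)
    have h2 : s ^ a * (L * M₁ / (4 * ε ^ 2)) ≤ s ^ a * (2 * ((L : ℝ) - 1) * M₁ / (4 * ε ^ 2)) := by
      refine mul_le_mul_of_nonneg_left ?_ hsa0
      exact div_le_div_of_nonneg_right (mul_le_mul_of_nonneg_right hLL hM0) (by positivity)
    refine (h1.trans h2).trans (le_of_eq ?_)
    field_simp
    ring
  rw [hpyth, mul_add]
  calc s * ∫ x, ((∑ w : Fin L → Bool, u (x.1, fun i => if w i then -x.2 i else x.2 i)) / 2 ^ L) ^ 2 ∂μ +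
        s * ∫ x, (u x - (∑ w : Fin L → Bool, u (x.1, fun i => if w i then -x.2 i else x.2 i)) / 2 ^ L) ^ 2 ∂μ
      ≤ C * ((L : ℝ) - 1) * s ^ a + s * (L * M₁ / (4 * ε ^ 2)) :=
        add_le_add hpat (mul_le_mul_of_nonneg_left hch hs.le)
    _ ≤ C * ((L : ℝ) - 1) * s ^ a + M₁ / (2 * ε ^ 2) * ((L : ℝ) - 1) * s ^ a := by linarith [hcharged]
    _ = (C + M₁ / (2 * ε ^ 2)) * ((L : ℝ) - 1) * s ^ a := by ring

end Chain


/-! ## Registered helper (notation-free restatement) -/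

/-- Registered helper sub-goal `helper_storageDecayOfPatternStorageDecay` of stub `stub_zeroFrequencyStorageDecay`
(line `abel-storage-decay`, crux stmt-AtomisticToContinuum-11977, lead c6): PATTERN-storage decay
`s·∫(P₀u_{L,s})² dμ_T ≤ C(L−1)s^a` implies zero-frequency storage decay `s·∫u_{L,s}² dμ_T ≤ C'(L−1)s^a`
(`storageDecay_of_patternStorageDecay`, restated): the flip-charged component of an Abel corrector stores at most
`L M₁/(4ε²)`, independently of `s`. [cite: BernardinOlla2011, §3] -/
theorem helper_storageDecayOfPatternStorageDecay : (∀ (ω₂ lam β γ T ε : ℝ), 0 < ω₂ → 0 < lam → 0 < β → 0 < γ → 0 < T → 0 < ε → ∃ a C : ℝ, 0 < a ∧ a ≤ 1 ∧ 0 ≤ C ∧ ∀ (L : ℕ), 2 ≤ L → ∀ s : ℝ, 0 < s → s ≤ 1 → ∀ u : Literature.MathematicalPhysics.KineticTheory.HeatConduction.PhaseSpace L → ℝ, (ContDiff ℝ 2 u ∧ MeasureTheory.MemLp u 2 ((Literature.MathematicalPhysics.KineticTheory.HeatConduction.pinnedChain ω₂ lam β γ).gibbsMeasure L T) ∧ ∀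 x, (Literature.MathematicalPhysics.KineticTheory.HeatConduction.pinnedChain ω₂ lam β γ).flipGenerator L T T ε u x = s * u x - ∑ i : Fin L, (Literature.MathematicalPhysics.KineticTheory.HeatConduction.pinnedChain ω₂ lam β γ).bondCurrent L i x) → s * MeasureTheory.integral ((Literature.MathematicalPhysics.KineticTheory.HeatConduction.pinnedChain ω₂ lam β γ).gibbsMeasure L T) (fun x => ((∑ w : Fin L → Bool, u (x.1, fun i => if w i then -x.2 i else x.2 i)) / 2 ^ L) ^ 2) ≤ C * ((L : ℝ) - 1) * s ^ a) → ∀ (ω₂ lam β γ T ε : ℝ), 0 < ω₂ → 0 < lam → 0 < β → 0 < γ → 0 < T → 0 < ε → ∃ a C : ℝ, 0 < a ∧ a ≤ 1 ∧ 0 ≤ C ∧ ∀ (L : ℕ), 2 ≤ L → ∀ s : ℝ, 0 < s → s ≤ 1 → ∀ u : Literature.MathematicalPhysics.KineticTheory.HeatConduction.PhaseSpace L → ℝ, (ContDiff ℝ 2 u ∧ MeasureTheory.MemLp u 2 ((Literature.MathematicalPhysics.KineticTheory.HeatConduction.pinnedChain ω₂ lam β γ).gibbsMeasure L T) ∧ ∀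 x, (Literature.MathematicalPhysics.KineticTheory.HeatConduction.pinnedChain ω₂ lam β γ).flipGenerator L T T ε u x = s * u x - ∑ i : Fin L, (Literature.MathematicalPhysics.KineticTheory.HeatConduction.pinnedChain ω₂ lam β γ).bondCurrent L i x) → s * MeasureTheory.integral ((Literature.MathematicalPhysics.KineticTheory.HeatConduction.pinnedChain ω₂ lam β γ).gibbsMeasure L T) (fun x => u x ^ 2) ≤ C * ((L : ℝ) - 1) * s ^ a :=
  fun hPS => storageDecay_of_patternStorageDecay hPS

end Summit.AtomisticToContinuum.FouriersLaw.Theorems.NoisyFourier.StorageDecay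

end
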